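import Mathlib
import HarnessLib
import Summits.NavierStokesRegularity.NavierStokesRegularity.Theorems.CompletionRelayChainRelayFrontStepIgnitionPiece
import Summits.NavierStokesRegularity.NavierStokesRegularity.Theorems.CompletionRelayChainRelayFrontStepIgnitionTable

/-!
# `CompletionRelayChain` — crux `RelayFrontStep` (24850), LINE `window_v2`, stub `stub_ignition` (Phase II):
  SOUNDNESS OF THE IGNITION CLOCK TABLE (blueprint §3)

Real semantics of `…IgnitionTable`: `log_le_logUp_real` (`log x ≤ logUp x`), `exp_le_of_inv_bound`
(`e^z ≤ G` from `1 ≤ G(1−z)`), the lower clock `clock_x2_lower`, and `runCheck_sound`: along a Phase-II window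
`[T*, t₁]` on which the relay rows hold with the table's defect constants and the front trigger is strictly increasing,
`runCheck st rows = true` carries the chain invariant («for every `t` with `u₁(t) ≤ level`: `x₂, r₁, u₂, −u₂, −r₁,
t − T*, ∫u₂²` under the state's envelopes») from `st` to the end state of every row — by induction on the rows, each
step being `piece_step_raw` on the piece that starts at the hitting time of the row's level (intermediate value
theorem) or at `T*`.

No definitions. HONEST FRAMING: MODEL lattice only (Tao 2016 §4 vocabulary); helper for one registered stub of an open
crux, no stub credit; nothing here is a statement about the Navier–Stokes equations.
-/

noncomputable section

-- the summit-side namespace repeats a component by design (D-0017)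
set_option linter.dupNamespace false

open Set MeasureTheory intervalIntegral Literature.Analysis.FluidPDE Literature.Analysis.FluidPDE.TaoCascade
open Summit.NavierStokesRegularity.NavierStokesRegularity.Theorems
open Summit.NavierStokesRegularity.NavierStokesRegularity.Theorems.RelayFrontStep

namespace Summit.NavierStokesRegularity.NavierStokesRegularity.Cruxes.RelayFrontStep.Window2

/-! ### Real-number helpers for the table -/

/-- `log x ≤ (x−1) − (x−1)²/2 + (x−1)³/3` for `x ≥ 1` (the derivative of the difference is `(x−1)³/x ≥ 0`). [folklore] -/
theorem log_le_logUp_real {x : ℝ} (hx : 1 ≤ x) :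
    Real.log x ≤ (x - 1) - (x - 1) ^ 2 / 2 + (x - 1) ^ 3 / 3 := by
  let g : ℝ → ℝ := fun y => y - y ^ 2 / 2 + y ^ 3 / 3 - Real.log (1 + y)
  have hderiv : ∀ y : ℝ, 0 ≤ y → HasDerivAt g (y ^ 3 / (1 + y)) y := by
    intro y hy
    have hy1 : (1 + y) ≠ 0 := by linarith
    have h1 : HasDerivAt (fun y : ℝ => y - y ^ 2 / 2 + y ^ 3 / 3) (1 - (2 : ℕ) * y ^ (2 - 1) / 2 + (3 : ℕ) * y ^ (3 - 1) / 3) y :=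
      ((hasDerivAt_id' y).sub ((hasDerivAt_pow 2 y).div_const 2)).add ((hasDerivAt_pow 3 y).div_const 3)
    have h2 : HasDerivAt (fun y : ℝ => Real.log (1 + y)) (1 / (1 + y)) y := by
      have h := ((hasDerivAt_id' y).const_add 1).log hy1
      exact h
    have h3 := h1.sub h2
    have e : (1 - (2 : ℕ) * y ^ (2 - 1) / 2 + (3 : ℕ) * y ^ (3 - 1) / 3 : ℝ) - 1 / (1 + y) = y ^ 3 / (1 + y) := by
      field_simp
      push_cast
      ring
    rw [e] at h3
    exact h3
  have hmono : MonotoneOn g (Ici 0) := by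
    refine monotoneOn_of_deriv_nonneg (convex_Ici 0) ?_ ?_ ?_
    · exact fun y hy => (hderiv y hy).continuousAt.continuousWithinAt
    · intro y hy
      rw [interior_Ici] at hy
      have hy' : 0 < y := hy
      exact (hderiv y hy'.le).differentiableAt.differentiableWithinAt
    · intro y hy
      rw [interior_Ici] at hy
      have hy' : 0 < y := hy
      rw [(hderiv y hy'.le).deriv]
      exact div_nonneg (pow_nonneg hy'.le 3) (by linarith)
  have h0 : g 0 = 0 := by simp [g]
  have h := hmono (self_mem_Ici) (show x - 1 ∈ Ici (0:ℝ) by simp; linarith) (by linarith)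
  rw [h0] at h
  simp only [g, add_sub_cancel] at h
  linarith

/-- `e^z ≤ G` from `0 ≤ z < 1` and `1 ≤ G(1 − z)` (`1 − z ≤ e^{−z}`). [folklore] -/
theorem exp_le_of_inv_bound {z G : ℝ} (hz1 : z < 1) (hG : 1 ≤ G * (1 - z)) : Real.exp z ≤ G := by
  have h1 : 1 - z ≤ Real.exp (-z) := by have := Real.add_one_le_exp (-z); linarith
  have hpos : 0 < 1 - z := by linarith
  have hG0 : 0 ≤ G := by nlinarith
  have h2 : Real.exp z * (1 - z) ≤ 1 := by
    have := mul_le_mul_of_nonneg_left h1 (Real.exp_pos z).le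
    rw [← Real.exp_add, add_neg_cancel, Real.exp_zero] at this
    exact this
  by_contra hc
  push Not at hc
  have : G * (1 - z) < Real.exp z * (1 - z) := mul_lt_mul_of_pos_right hc hpos
  linarith

/-- **Lower clock** (mirror of `clock_integral_le`): on `[a,b] ⊆ [0,τ]`, if `0 ≤ u ≤ Ub`, `u′ ≤ ΛMu + ε'` (`M > 0`) and
`x₂′ ≥ Λu² − ε₂`, then `x₂(t) − x₂(a) ≥ (u(t)² − u(a)²)/(2M) − (Ub·ε'/M + ε₂)(t − a)`. [folklore] -/
theorem clock_x2_lower {u x₂ : ℝ → ℝ} {τ a b Λ M Ub ε' ε₂ : ℝ} (hτ : 0 < τ) (hu : ContDiffOn ℝ 1 u (Icc 0 τ))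
    (hx₂ : ContDiffOn ℝ 1 x₂ (Icc 0 τ)) (ha : 0 ≤ a) (hab : a ≤ b) (hb : b ≤ τ) (hM : 0 < M) (hε' : 0 ≤ ε')
    (hpos : ∀ s ∈ Icc a b, 0 ≤ u s) (hUb : ∀ s ∈ Icc a b, u s ≤ Ub)
    (hu'up : ∀ s ∈ Icc a b, derivWithin u (Icc 0 τ) s ≤ Λ * M * u s + ε')
    (hx₂'lo : ∀ s ∈ Icc a b, Λ * u s ^ 2 - ε₂ ≤ derivWithin x₂ (Icc 0 τ) s) :
    ∀ t ∈ Icc a b, x₂ a + (u t ^ 2 - u a ^ 2) / (2 * M) - (Ub * ε' / M + ε₂) * (t - a) ≤ x₂ t := by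
  have hsubI : Icc a b ⊆ Icc 0 τ := Icc_subset_Icc ha hb
  have hF : ContDiffOn ℝ 1 (fun s => x₂ s - u s * u s / (2 * M)) (Icc 0 τ) := hx₂.sub ((hu.mul hu).div_const _)
  have key : ∀ s ∈ Icc a b, -(Ub * ε' / M + ε₂) ≤ derivWithin (fun s => x₂ s - u s * u s / (2 * M)) (Icc 0 τ) s := by
    intro s hs
    have hsI : s ∈ Icc 0 τ := hsubI hs
    have hud : DifferentiableWithinAt ℝ u (Icc 0 τ) s := (hu.differentiableOn one_ne_zero) s hsI
    have hxd : DifferentiableWithinAt ℝ x₂ (Icc 0 τ) s := (hx₂.differentiableOn one_ne_zero) s hsI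
    have huniq : UniqueDiffWithinAt ℝ (Icc 0 τ) s := uniqueDiffOn_Icc hτ s hsI
    have hder : HasDerivWithinAt (fun s => x₂ s - u s * u s / (2 * M))
        (derivWithin x₂ (Icc 0 τ) s -
          (derivWithin u (Icc 0 τ) s * u s + u s * derivWithin u (Icc 0 τ) s) / (2 * M)) (Icc 0 τ) s :=
      hxd.hasDerivWithinAt.sub ((hud.hasDerivWithinAt.mul hud.hasDerivWithinAt).div_const (2 * M))
    rw [hder.derivWithin huniq]
    have h1 := hu'up s hs; have h2 := hx₂'lo s hs; have h3 := hpos s hs; have h4 := hUb s hs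
    -- u u' ≤ Λ M u² + u ε' ≤ Λ M u² + Ub ε'
    have h5 : u s * derivWithin u (Icc 0 τ) s ≤ Λ * M * u s ^ 2 + Ub * ε' := by
      have := mul_le_mul_of_nonneg_left h1 h3
      nlinarith [mul_le_mul_of_nonneg_right h4 hε']
    have e : (derivWithin u (Icc 0 τ) s * u s + u s * derivWithin u (Icc 0 τ) s) / (2 * M) =
        (u s * derivWithin u (Icc 0 τ) s) / M := by field_simp; ring
    rw [e]
    have h6 : u s * derivWithin u (Icc 0 τ) s / M ≤ Λ * u s ^ 2 + Ub * ε' / M := by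
      rw [div_le_iff₀ hM]
      have : (Λ * u s ^ 2 + Ub * ε' / M) * M = Λ * M * u s ^ 2 + Ub * ε' := by field_simp
      rw [this]; exact h5
    linarith
  intro t ht
  have h := lower_linear_of_derivWithin_ge hτ hF ha hab hb key t ht
  have e1 : u t * u t / (2 * M) - u a * u a / (2 * M) = (u t ^ 2 - u a ^ 2) / (2 * M) := by ring
  have e2 : (u t ^ 2 - u a ^ 2) / (2 * M) = u t * u t / (2 * M) - u a * u a / (2 * M) := by ring
  rw [e2]
  linarith

/-! ### Soundness of the table run -/

variable {τ κ₁ κ₂ : ℝ} {α : Fin 4 → Fin 4 → Fin 4 → ℤ × ℤ × ℤ → ℝ}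
  {S₀ F₀ B₀ : Fin 4 → ℤ → ℝ} {S F : Fin 4 → ℤ → ℝ → ℝ}

set_option maxHeartbeats 1600000 in
/-- **ROW SOUNDNESS → CHAIN.** Along the Phase-II window `[T*, t₁]` (all row inequalities of the flow holding with the
table's constants, the front trigger strictly increasing, start data under `initState`), if `runCheck st rows = true`
and the invariant holds at the state `st` (for every `t` with `u₁(t) ≤ st.w`: `x₂ ≤ st.X2`, `r₁ ≤ st.R1`, `u₂ ≤ st.U2`,
`−u₂ ≤ st.U2m`, `−r₁ ≤ st.R1m`, `t − T* ≤ st.T`, `∫_{T*}^t u₂² ≤ st.I`), then it holds at the end state of every row.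
[this file] -/
theorem runCheck_sound (h : PseudoFlowOn τ 1 α κ₁ κ₂ S₀ F₀ B₀ S F) (hτ : 0 < τ)
    {t₁ Λ Lu Mu : ℝ} (hT1 : Tstar ≤ t₁) (h1τ : t₁ ≤ τ) (hlen : t₁ - Tstar ≤ 7 / 10)
    (hΛlo : ((cL1lo : ℚ) : ℝ) ≤ Λ) (hLu : 0 ≤ Lu)
    (k : ℝ → ℝ) (hk : ContinuousOn k (Icc 0 τ))
    -- rows of the flow on the window
    (hs₀ : ∀ s ∈ Icc Tstar t₁, ((cS0 : ℚ) : ℝ) ≤ S 0 1 s + S 0 2 s)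
    (hx₂' : ∀ s ∈ Icc Tstar t₁, derivWithin (S 0 2) (Icc 0 τ) s ≤ Λ * S 1 1 s ^ 2 + ((cEx : ℚ) : ℝ))
    (hu' : ∀ s ∈ Icc Tstar t₁, Λ * (S 0 1 s - S 0 2 s) * S 1 1 s - ((cE1 : ℚ) : ℝ) ≤ derivWithin (S 1 1) (Icc 0 τ) s)
    (hu'crude : ∀ s ∈ Icc Tstar t₁, -Lu ≤ derivWithin (S 1 1) (Icc 0 τ) s)
    (hMu : ∀ s ∈ Icc Tstar t₁, |S 1 1 s| ≤ Mu)
    (hr₁' : ∀ s ∈ Icc Tstar t₁, derivWithin (S 2 1) (Icc 0 τ) s ≤ Λ / 32 * S 1 1 s * S 0 2 s + ((cEr : ℚ) : ℝ))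
    (hr₁'lo : ∀ s ∈ Icc Tstar t₁,
      -(((cL32 : ℚ) : ℝ) * S 1 1 s * max (S 1 2 s) 0) - ((cErl : ℚ) : ℝ) ≤ derivWithin (S 2 1) (Icc 0 τ) s)
    (hu₂' : ∀ s ∈ Icc Tstar t₁, derivWithin (S 1 2) (Icc 0 τ) s ≤
      k s * S 1 2 s + (((cB0 : ℚ) : ℝ) + ((cL32 : ℚ) : ℝ) * max (S 2 1 s) 0 * S 1 1 s))
    (hu₂'m : ∀ s ∈ Icc Tstar t₁, derivWithin (fun r => -S 1 2 r) (Icc 0 τ) s ≤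
      k s * (-S 1 2 s) + (((cB0 : ℚ) : ℝ) + ((cL32 : ℚ) : ℝ) * max (-S 2 1 s) 0 * S 1 1 s))
    (hk0 : ∀ s ∈ Icc Tstar t₁, 0 ≤ k s) (hkx : ∀ s ∈ Icc Tstar t₁, k s ≤ 32 * (S 0 2 s + ((cK : ℚ) : ℝ)))
    (hstrict : ∀ s ∈ Icc Tstar t₁, ∀ t ∈ Icc Tstar t₁, s < t → S 1 1 s < S 1 1 t)
    -- start data at T*
    (hx₂T : S 0 2 Tstar ≤ ((cC2 : ℚ) : ℝ) + 10 / 19 * S 1 1 Tstar ^ 2)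
    (hr₁T : S 2 1 Tstar ≤ ((initState.R1 : ℚ) : ℝ)) (hu₂T : S 1 2 Tstar ≤ ((initState.U2 : ℚ) : ℝ))
    (hu₂Tm : -S 1 2 Tstar ≤ ((initState.U2m : ℚ) : ℝ)) (hr₁Tm : -S 2 1 Tstar ≤ ((initState.R1m : ℚ) : ℝ)) :
    ∀ (rows : List ClockRow) (st : ClockState), runCheck st rows = true →
      (((initState.w : ℚ) : ℝ) ≤ ((st.w : ℚ) : ℝ) ∧ ((initState.R1 : ℚ) : ℝ) ≤ ((st.R1 : ℚ) : ℝ) ∧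
        ((initState.U2 : ℚ) : ℝ) ≤ ((st.U2 : ℚ) : ℝ) ∧ ((initState.U2m : ℚ) : ℝ) ≤ ((st.U2m : ℚ) : ℝ) ∧
        ((initState.R1m : ℚ) : ℝ) ≤ ((st.R1m : ℚ) : ℝ) ∧ 0 ≤ ((st.T : ℚ) : ℝ) ∧ 0 ≤ ((st.I : ℚ) : ℝ)) →
      (∀ t ∈ Icc Tstar t₁, S 1 1 t ≤ ((st.w : ℚ) : ℝ) →
        S 0 2 t ≤ ((st.X2 : ℚ) : ℝ) ∧ S 2 1 t ≤ ((st.R1 : ℚ) : ℝ) ∧ S 1 2 t ≤ ((st.U2 : ℚ) : ℝ) ∧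
          -S 1 2 t ≤ ((st.U2m : ℚ) : ℝ) ∧ -S 2 1 t ≤ ((st.R1m : ℚ) : ℝ) ∧ t - Tstar ≤ ((st.T : ℚ) : ℝ) ∧
          (∫ s in Tstar..t, S 1 2 s ^ 2) ≤ ((st.I : ℚ) : ℝ)) →
      ∀ r ∈ rows, ∀ t ∈ Icc Tstar t₁, S 1 1 t ≤ ((r.wb : ℚ) : ℝ) →
        S 0 2 t ≤ ((r.X2 : ℚ) : ℝ) ∧ S 2 1 t ≤ ((r.R1 : ℚ) : ℝ) ∧ S 1 2 t ≤ ((r.U2 : ℚ) : ℝ) ∧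
          -S 1 2 t ≤ ((r.U2m : ℚ) : ℝ) ∧ -S 2 1 t ≤ ((r.R1m : ℚ) : ℝ) ∧ t - Tstar ≤ ((r.T : ℚ) : ℝ) ∧
          (∫ s in Tstar..t, S 1 2 s ^ 2) ≤ ((r.I : ℚ) : ℝ) := by
  have hT0 : (0 : ℝ) ≤ Tstar := by unfold Tstar; norm_num
  have hsubW : Icc Tstar t₁ ⊆ Icc 0 τ := Icc_subset_Icc hT0 h1τ
  have hΛlo' : (0 : ℝ) < ((cL1lo : ℚ) : ℝ) := by norm_num [cL1lo]
  have hL32nn : (0 : ℝ) ≤ ((cL32 : ℚ) : ℝ) := by norm_num [cL32]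
  intro rows
  induction rows with
  | nil => intro st _ _ _ r hr; cases hr
  | cons r rs ih =>
    intro st hrun hdom hInv
    simp only [runCheck, Bool.and_eq_true] at hrun
    obtain ⟨hrow, hrest⟩ := hrun
    -- unpack the row check into real inequalities
    simp only [rowCheck, Bool.and_eq_true, decide_eq_true_eq, beq_iff_eq] at hrow
    obtain ⟨⟨⟨⟨⟨⟨⟨⟨⟨⟨⟨⟨⟨⟨⟨⟨⟨⟨⟨⟨⟨⟨⟨⟨⟨⟨⟨⟨⟨⟨⟨⟨⟨⟨⟨hw, hab⟩, hb2⟩, hm0⟩, hm1⟩, hdm0⟩, hds0⟩, c1⟩, c2⟩, c2'⟩, c2''⟩, c3⟩,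
      c3'⟩, c3''⟩, c4⟩, c5⟩, c5'⟩, hz0⟩, hz1⟩, hG⟩, c6⟩, c6''⟩, c7⟩, c7'⟩, c8⟩, c8'⟩, c8''⟩, c9T⟩, c9I⟩,
      mX2⟩, mR1⟩, mU2⟩, mU2m⟩, mR1m⟩, mT⟩, mI⟩ := hrow
    -- real versions of the rational row inequalities
    have q1 : ((r.m : ℚ) : ℝ) ≤ ((cS0 : ℚ) : ℝ) - 2 * ((1001 / 1000) * ((r.X2 : ℚ) : ℝ)) - ((r.dm : ℚ) : ℝ) := by
      have h' := (Rat.cast_le (K := ℝ)).mpr c1; push_cast at h'; linarith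
    have qm0 : (0 : ℝ) < ((r.m : ℚ) : ℝ) := by exact_mod_cast hm0
    have qm1 : ((r.m : ℚ) : ℝ) ≤ 19 / 20 := by
      have h' := (Rat.cast_le (K := ℝ)).mpr hm1; push_cast at h'; linarith
    have qdm0 : (0 : ℝ) ≤ ((r.dm : ℚ) : ℝ) := by exact_mod_cast hdm0
    have qds0 : (0 : ℝ) ≤ ((r.ds : ℚ) : ℝ) := by exact_mod_cast hds0
    have qab : ((r.wa : ℚ) : ℝ) < ((r.wb : ℚ) : ℝ) := by exact_mod_cast hab
    have q2 : ((cE1 : ℚ) : ℝ) ≤ ((cL1lo : ℚ) : ℝ) * ((r.dm : ℚ) : ℝ) * (((r.wa : ℚ) : ℝ) - (1001 / 1000) * ((cD : ℚ) : ℝ)) := by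
      have h' := (Rat.cast_le (K := ℝ)).mpr c2; push_cast at h'; linarith
    have q2' : (1001 / 1000) * ((cD : ℚ) : ℝ) < ((r.wa : ℚ) : ℝ) := by
      have h' := (Rat.cast_lt (K := ℝ)).mpr c2'; push_cast at h'; linarith
    have q2'' : ((cE1 : ℚ) : ℝ) * (7 / 10) ≤ ((cD : ℚ) : ℝ) := by
      have h' := (Rat.cast_le (K := ℝ)).mpr c2''; push_cast at h'; linarith
    have q3 : ((st.X2 : ℚ) : ℝ) + (((r.wb : ℚ) : ℝ) ^ 2 - ((r.wa : ℚ) : ℝ) ^ 2) / (2 * ((r.m : ℚ) : ℝ)) +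
        ((cEx : ℚ) : ℝ) * (7 / 10) ≤ ((r.X2 : ℚ) : ℝ) := by
      have h' := (Rat.cast_le (K := ℝ)).mpr c3; push_cast at h'; linarith
    have q3' : (0 : ℝ) < ((r.X2 : ℚ) : ℝ) := by exact_mod_cast c3'
    have q3'' : ((cC2 : ℚ) : ℝ) + 10 / 19 * ((r.wa : ℚ) : ℝ) ^ 2 ≤ ((st.X2 : ℚ) : ℝ) := by
      have h' := (Rat.cast_le (K := ℝ)).mpr c3''; push_cast at h'; linarith
    have q5 : ((st.R1 : ℚ) : ℝ) + ((r.X2 : ℚ) : ℝ) * (((r.wb : ℚ) : ℝ) - ((r.wa : ℚ) : ℝ)) / (32 * ((r.m : ℚ) : ℝ)) +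
        ((cEr : ℚ) : ℝ) * ((r.ds : ℚ) : ℝ) ≤ ((r.R1 : ℚ) : ℝ) := by
      have h' := (Rat.cast_le (K := ℝ)).mpr c5; push_cast at h'; linarith
    have q5' : (0 : ℝ) ≤ ((r.R1 : ℚ) : ℝ) := by exact_mod_cast c5'
    have qz1 : 32 * (((r.X2 : ℚ) : ℝ) + ((cK : ℚ) : ℝ)) * ((r.ds : ℚ) : ℝ) < 1 := by
      have h' := (Rat.cast_lt (K := ℝ)).mpr hz1; push_cast at h'; linarith
    have qG : 1 ≤ ((r.G : ℚ) : ℝ) * (1 - 32 * (((r.X2 : ℚ) : ℝ) + ((cK : ℚ) : ℝ)) * ((r.ds : ℚ) : ℝ)) := by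
      have h' := (Rat.cast_le (K := ℝ)).mpr hG; push_cast at h'; linarith
    have q6 : (((st.U2 : ℚ) : ℝ) + (((cB0 : ℚ) : ℝ) + ((cL32 : ℚ) : ℝ) * ((r.R1 : ℚ) : ℝ) * ((r.wb : ℚ) : ℝ)) *
        ((r.ds : ℚ) : ℝ)) * ((r.G : ℚ) : ℝ) ≤ ((r.U2 : ℚ) : ℝ) := by
      have h' := (Rat.cast_le (K := ℝ)).mpr c6; push_cast at h'; linarith
    have q6'' : (0 : ℝ) ≤ ((st.U2 : ℚ) : ℝ) := by exact_mod_cast c6''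
    have q7 : (((st.U2m : ℚ) : ℝ) + (((cB0 : ℚ) : ℝ) + ((cL32 : ℚ) : ℝ) * ((r.R1m : ℚ) : ℝ) * ((r.wb : ℚ) : ℝ)) *
        ((r.ds : ℚ) : ℝ)) * ((r.G : ℚ) : ℝ) ≤ ((r.U2m : ℚ) : ℝ) := by
      have h' := (Rat.cast_le (K := ℝ)).mpr c7; push_cast at h'; linarith
    have q7' : (0 : ℝ) ≤ ((st.U2m : ℚ) : ℝ) := by exact_mod_cast c7'
    have q8 : ((st.R1m : ℚ) : ℝ) + (((cL32 : ℚ) : ℝ) * ((r.wb : ℚ) : ℝ) * ((r.U2 : ℚ) : ℝ) + ((cErl : ℚ) : ℝ)) *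
        ((r.ds : ℚ) : ℝ) ≤ ((r.R1m : ℚ) : ℝ) := by
      have h' := (Rat.cast_le (K := ℝ)).mpr c8; push_cast at h'; linarith
    have q8' : (0 : ℝ) ≤ ((r.U2 : ℚ) : ℝ) := by exact_mod_cast c8'
    have q8'' : (0 : ℝ) ≤ ((st.R1m : ℚ) : ℝ) := by exact_mod_cast c8''
    have q9T : ((st.T : ℚ) : ℝ) + ((r.ds : ℚ) : ℝ) ≤ ((r.T : ℚ) : ℝ) := by exact_mod_cast c9T
    have q9I : ((st.I : ℚ) : ℝ) + ((max r.U2 r.U2m : ℚ) : ℝ) ^ 2 * ((r.ds : ℚ) : ℝ) ≤ ((r.I : ℚ) : ℝ) := by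
      exact_mod_cast c9I
    have qX2 : ((st.X2 : ℚ) : ℝ) ≤ ((r.X2 : ℚ) : ℝ) := by exact_mod_cast mX2
    have qR1 : ((st.R1 : ℚ) : ℝ) ≤ ((r.R1 : ℚ) : ℝ) := by exact_mod_cast mR1
    have qU2 : ((st.U2 : ℚ) : ℝ) ≤ ((r.U2 : ℚ) : ℝ) := by exact_mod_cast mU2
    have qU2m : ((st.U2m : ℚ) : ℝ) ≤ ((r.U2m : ℚ) : ℝ) := by exact_mod_cast mU2m
    have qR1m : ((st.R1m : ℚ) : ℝ) ≤ ((r.R1m : ℚ) : ℝ) := by exact_mod_cast mR1m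
    have qT : ((st.T : ℚ) : ℝ) ≤ ((r.T : ℚ) : ℝ) := by exact_mod_cast mT
    have qI : ((st.I : ℚ) : ℝ) ≤ ((r.I : ℚ) : ℝ) := by exact_mod_cast mI
    have qD0 : (0 : ℝ) < ((cD : ℚ) : ℝ) := by norm_num [cD]
    have hU2init : (0 : ℝ) ≤ ((initState.U2 : ℚ) : ℝ) := by norm_num [initState]
    have hU2minit : (0 : ℝ) ≤ ((initState.U2m : ℚ) : ℝ) := by norm_num [initState]
    have hR1minit : (0 : ℝ) ≤ ((initState.R1m : ℚ) : ℝ) := by norm_num [initState]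
    -- the invariant at the end state of r
    have hInv' : ∀ t ∈ Icc Tstar t₁, S 1 1 t ≤ ((r.wb : ℚ) : ℝ) →
        S 0 2 t ≤ ((r.X2 : ℚ) : ℝ) ∧ S 2 1 t ≤ ((r.R1 : ℚ) : ℝ) ∧ S 1 2 t ≤ ((r.U2 : ℚ) : ℝ) ∧
          -S 1 2 t ≤ ((r.U2m : ℚ) : ℝ) ∧ -S 2 1 t ≤ ((r.R1m : ℚ) : ℝ) ∧ t - Tstar ≤ ((r.T : ℚ) : ℝ) ∧
          (∫ s in Tstar..t, S 1 2 s ^ 2) ≤ ((r.I : ℚ) : ℝ) := by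
      intro t ht hle
      by_cases hcase : S 1 1 t ≤ ((st.w : ℚ) : ℝ)
      · -- still below the previous level: previous invariant and monotone columns
        obtain ⟨i1, i2, i3, i4, i5, i6, i7⟩ := hInv t ht hcase
        exact ⟨i1.trans qX2, i2.trans qR1, i3.trans qU2, i4.trans qU2m, i5.trans qR1m, i6.trans qT, i7.trans qI⟩
      · push Not at hcase
        rw [hw] at hcase
        -- the piece start a ∈ [T*, t]: the hitting time of level wa if u(T*) ≤ wa, else T*
        have hstart : ∃ a ∈ Icc Tstar t, ((r.wa : ℚ) : ℝ) ≤ S 1 1 a ∧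
            S 0 2 a ≤ ((st.X2 : ℚ) : ℝ) + (S 1 1 a ^ 2 - ((r.wa : ℚ) : ℝ) ^ 2) / (2 * ((r.m : ℚ) : ℝ)) ∧
            S 2 1 a ≤ ((st.R1 : ℚ) : ℝ) ∧ S 1 2 a ≤ ((st.U2 : ℚ) : ℝ) ∧ -S 1 2 a ≤ ((st.U2m : ℚ) : ℝ) ∧
            -S 2 1 a ≤ ((st.R1m : ℚ) : ℝ) ∧ a - Tstar ≤ ((st.T : ℚ) : ℝ) ∧
            (∫ s in Tstar..a, S 1 2 s ^ 2) ≤ ((st.I : ℚ) : ℝ) ∧ (∀ s ∈ Icc a t, ((r.wa : ℚ) : ℝ) - 0 ≤ S 1 1 s) := by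
          by_cases hmode : S 1 1 Tstar ≤ ((r.wa : ℚ) : ℝ)
          · -- hitting time by the intermediate value theorem
            have hcont : ContinuousOn (S 1 1) (Icc Tstar t) :=
              (h.contDiffOn_S 1 1).continuousOn.mono (Icc_subset_Icc hT0 (ht.2.trans h1τ))
            have hmem : ((r.wa : ℚ) : ℝ) ∈ Icc (S 1 1 Tstar) (S 1 1 t) := ⟨hmode, hcase.le⟩
            obtain ⟨a, ha, hua⟩ := intermediate_value_Icc ht.1 hcont hmem
            have haW : a ∈ Icc Tstar t₁ := ⟨ha.1, ha.2.trans ht.2⟩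
            have hwa : S 1 1 a ≤ ((st.w : ℚ) : ℝ) := by rw [hw, hua]
            obtain ⟨i1, i2, i3, i4, i5, i6, i7⟩ := hInv a haW hwa
            refine ⟨a, ha, hua.symm.le, ?_, i2, i3, i4, i5, i6, i7, ?_⟩
            · rw [hua, sub_self, zero_div, add_zero]; exact i1
            · intro s hs
              rcases eq_or_lt_of_le hs.1 with heq | hlt
              · rw [← heq, hua, sub_zero]
              · have := hstrict a haW s ⟨haW.1.trans hs.1, hs.2.trans ht.2⟩ hlt
                rw [hua] at this; linarith
          · push Not at hmode
            refine ⟨Tstar, ⟨le_rfl, ht.1⟩, hmode.le, ?_, ?_, ?_, ?_, ?_, by simpa using hdom.2.2.2.2.2.1, ?_, ?_⟩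
            · -- x₂(T*) ≤ c₂ + (10/19)u² ≤ st.X2 + (u² − wa²)/(2m), since c₂ + (10/19)wa² ≤ st.X2 and 10/19 ≤ 1/(2m)
              have hd : 0 ≤ S 1 1 Tstar ^ 2 - ((r.wa : ℚ) : ℝ) ^ 2 := by
                have hwapos : 0 ≤ ((r.wa : ℚ) : ℝ) := by linarith [qD0, q2']
                nlinarith
              have hslope : 10 / 19 * (S 1 1 Tstar ^ 2 - ((r.wa : ℚ) : ℝ) ^ 2) ≤
                  (S 1 1 Tstar ^ 2 - ((r.wa : ℚ) : ℝ) ^ 2) / (2 * ((r.m : ℚ) : ℝ)) := by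
                rw [le_div_iff₀ (by positivity)]; nlinarith
              linarith
            · exact hr₁T.trans hdom.2.1
            · exact hu₂T.trans hdom.2.2.1
            · exact hu₂Tm.trans hdom.2.2.2.1
            · exact hr₁Tm.trans hdom.2.2.2.2.1
            · simpa using hdom.2.2.2.2.2.2
            · intro s hs
              rcases eq_or_lt_of_le hs.1 with heq | hlt
              · rw [← heq]; linarith only [hmode]
              · have := hstrict Tstar ⟨le_rfl, hT1⟩ s ⟨hs.1, hs.2.trans ht.2⟩ hlt; linarith only [hmode, this]
        obtain ⟨a, ha, hwa, hxa, hra, hua2, hua2m, hram, hTa, hIa, hband⟩ := hstart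
        have haW : a ∈ Icc Tstar t₁ := ⟨ha.1, ha.2.trans ht.2⟩
        have hsub : Icc a t ⊆ Icc Tstar t₁ := fun s hs => ⟨ha.1.trans hs.1, hs.2.trans ht.2⟩
        have ha0 : 0 ≤ a := hT0.trans ha.1
        -- u ≤ wb on [a, t] by strict monotonicity
        have hwn : ∀ s ∈ Icc a t, S 1 1 s ≤ ((r.wb : ℚ) : ℝ) := by
          intro s hs
          rcases eq_or_lt_of_le hs.2 with heq | hlt
          · rw [heq]; exact hle
          · exact (le_of_lt (hstrict s (hsub hs) t ht hlt)).trans hle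
        -- the piece
        have hlog : Real.log (((r.wb : ℚ) : ℝ) / ((r.wa : ℚ) : ℝ)) ≤ ((r.ds : ℚ) : ℝ) * (Λ * ((r.m : ℚ) : ℝ)) := by
          have hwapos : 0 < ((r.wa : ℚ) : ℝ) := by linarith [qD0, q2']
          have hx1 : 1 ≤ ((r.wb : ℚ) : ℝ) / ((r.wa : ℚ) : ℝ) := by rw [le_div_iff₀ hwapos]; linarith
          have h1 := log_le_logUp_real hx1
          have h2 : ((logUp (r.wb / r.wa) : ℚ) : ℝ) ≤ ((r.ds : ℚ) : ℝ) * (((cL1lo : ℚ) : ℝ) * ((r.m : ℚ) : ℝ)) := by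
            have h' := (Rat.cast_le (K := ℝ)).mpr c4; push_cast at h' ⊢; linarith
          have h3 : ((logUp (r.wb / r.wa) : ℚ) : ℝ) = (((r.wb : ℚ) : ℝ) / ((r.wa : ℚ) : ℝ) - 1) -
              (((r.wb : ℚ) : ℝ) / ((r.wa : ℚ) : ℝ) - 1) ^ 2 / 2 + (((r.wb : ℚ) : ℝ) / ((r.wa : ℚ) : ℝ) - 1) ^ 3 / 3 := by
            simp only [logUp]; push_cast; ring
          have h4 : ((r.ds : ℚ) : ℝ) * (((cL1lo : ℚ) : ℝ) * ((r.m : ℚ) : ℝ)) ≤ ((r.ds : ℚ) : ℝ) * (Λ * ((r.m : ℚ) : ℝ)) :=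
            mul_le_mul_of_nonneg_left (mul_le_mul_of_nonneg_right hΛlo qm0.le) qds0
          linarith
        have hexp : Real.exp (32 * (((r.X2 : ℚ) : ℝ) + ((cK : ℚ) : ℝ)) * ((r.ds : ℚ) : ℝ)) ≤ ((r.G : ℚ) : ℝ) := by
          exact exp_le_of_inv_bound qz1 qG
        have P := piece_step_raw (x₁ := S 0 1) (k := k) (Λlo := ((cL1lo : ℚ) : ℝ)) (L32 := ((cL32 : ℚ) : ℝ))
          (εx := ((cEx : ℚ) : ℝ)) (ε₁ := ((cE1 : ℚ) : ℝ)) (εr := ((cEr : ℚ) : ℝ)) (εrl := ((cErl : ℚ) : ℝ))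
          (β₀ := ((cB0 : ℚ) : ℝ)) (cK := ((cK : ℚ) : ℝ)) (Mu := Mu) (s₀ := ((cS0 : ℚ) : ℝ))
          (m := ((r.m : ℚ) : ℝ)) (dm := ((r.dm : ℚ) : ℝ)) (D := ((cD : ℚ) : ℝ)) (wj := ((r.wa : ℚ) : ℝ))
          (wn := ((r.wb : ℚ) : ℝ)) (Xj := ((st.X2 : ℚ) : ℝ)) (Xn := ((r.X2 : ℚ) : ℝ)) (Rj := ((st.R1 : ℚ) : ℝ))
          (Rn := ((r.R1 : ℚ) : ℝ)) (Uj := ((st.U2 : ℚ) : ℝ)) (Un := ((r.U2 : ℚ) : ℝ)) (Umj := ((st.U2m : ℚ) : ℝ))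
          (Umn := ((r.U2m : ℚ) : ℝ)) (Rmj := ((st.R1m : ℚ) : ℝ)) (Rmn := ((r.R1m : ℚ) : ℝ)) (ds := ((r.ds : ℚ) : ℝ))
          (G := ((r.G : ℚ) : ℝ))
          hτ (h.contDiffOn_S 1 1) (h.contDiffOn_S 0 2) (h.contDiffOn_S 2 1) (h.contDiffOn_S 1 2) hk ha0 ha.2
          (ht.2.trans h1τ) (by linarith [ha.1, ht.2]) hΛlo' hΛlo (by simp [cEx]; norm_num) (by simp [cE1]; norm_num)
          (by simp [cEr]; norm_num) (by simp [cErl]; norm_num) (by simp [cB0]; norm_num) hL32nn (by simp [cK]; norm_num)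
          hwa hwn (fun s hs => hMu s (hsub hs)) (fun s hs => hs₀ s (hsub hs)) (fun s hs => hx₂' s (hsub hs))
          (fun s hs => hu' s (hsub hs)) hLu (fun s hs => hu'crude s (hsub hs)) (fun s hs => hr₁' s (hsub hs))
          (fun s hs => hr₁'lo s (hsub hs)) (fun s hs => hu₂' s (hsub hs)) (fun s hs => hu₂'m s (hsub hs))
          (fun s hs => hk0 s (hsub hs)) (fun s hs => hkx s (hsub hs)) hxa hra hua2 hua2m hram
          q1 qm0 qdm0 q2 q2' q2'' qD0 q3 q3' hlog qds0 q5 q5' q6 hexp (hU2init.trans hdom.2.2.1) q7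
          (hU2minit.trans hdom.2.2.2.1) q8 q8' (hR1minit.trans hdom.2.2.2.2.1)
        obtain ⟨pX, _, _, pT, pR, pU, pUm, pRm⟩ := P t ⟨ha.2, le_rfl⟩
        refine ⟨pX, pR, pU, pUm, pRm, ?_, ?_⟩
        · linarith [q9T, hTa, pT]
        · -- the integral: split at a, and |u₂| ≤ max U2 U2m on [a, t]
          have hia : IntervalIntegrable (fun s => S 1 2 s ^ 2) volume Tstar a :=
            (((h.contDiffOn_S 1 2).continuousOn.mono (by
              rw [uIcc_of_le ha.1]; exact Icc_subset_Icc hT0 (haW.2.trans h1τ))).pow 2).intervalIntegrable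
          have hib : IntervalIntegrable (fun s => S 1 2 s ^ 2) volume a t :=
            (((h.contDiffOn_S 1 2).continuousOn.mono (by
              rw [uIcc_of_le ha.2]; exact Icc_subset_Icc ha0 (ht.2.trans h1τ))).pow 2).intervalIntegrable
          rw [← intervalIntegral.integral_add_adjacent_intervals hia hib]
          have hpiece : ∀ s ∈ Icc a t, S 1 2 s ^ 2 ≤ ((max r.U2 r.U2m : ℚ) : ℝ) ^ 2 := by
            intro s hs
            obtain ⟨_, _, _, _, _, qU, qUm, _⟩ := P s hs
            have hM : |S 1 2 s| ≤ ((max r.U2 r.U2m : ℚ) : ℝ) := by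
              rw [abs_le]; push_cast; constructor
              · linarith [le_max_right ((r.U2 : ℚ) : ℝ) ((r.U2m : ℚ) : ℝ)]
              · linarith [le_max_left ((r.U2 : ℚ) : ℝ) ((r.U2m : ℚ) : ℝ)]
            rw [← sq_abs]; exact pow_le_pow_left₀ (abs_nonneg _) hM 2
          have hint2 : (∫ s in a..t, S 1 2 s ^ 2) ≤ ((max r.U2 r.U2m : ℚ) : ℝ) ^ 2 * (t - a) := by
            have := intervalIntegral.integral_mono_on ha.2 hib (by simp) hpiece
            rwa [intervalIntegral.integral_const, smul_eq_mul, mul_comm] at this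
          have hta : t - a ≤ ((r.ds : ℚ) : ℝ) := pT
          have hmax0 : (0 : ℝ) ≤ ((max r.U2 r.U2m : ℚ) : ℝ) ^ 2 := sq_nonneg _
          have hm2 := mul_le_mul_of_nonneg_left hta hmax0
          linarith [q9I, hIa, hint2, hm2]
    -- conclude for r and recurse
    intro r' hr' t ht hle
    rcases List.mem_cons.mp hr' with heq | hmem
    · rw [heq] at hle ⊢; exact hInv' t ht hle
    · have hdom' : ((initState.w : ℚ) : ℝ) ≤ ((r.toState.w : ℚ) : ℝ) ∧ ((initState.R1 : ℚ) : ℝ) ≤ ((r.toState.R1 : ℚ) : ℝ) ∧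
          ((initState.U2 : ℚ) : ℝ) ≤ ((r.toState.U2 : ℚ) : ℝ) ∧ ((initState.U2m : ℚ) : ℝ) ≤ ((r.toState.U2m : ℚ) : ℝ) ∧
          ((initState.R1m : ℚ) : ℝ) ≤ ((r.toState.R1m : ℚ) : ℝ) ∧ 0 ≤ ((r.toState.T : ℚ) : ℝ) ∧ 0 ≤ ((r.toState.I : ℚ) : ℝ) := by
        obtain ⟨d1, d2, d3, d4, d5, d6, d7⟩ := hdom
        rw [hw] at d1
        exact ⟨d1.trans qab.le, d2.trans qR1, d3.trans qU2, d4.trans qU2m, d5.trans qR1m, d6.trans qT, d7.trans qI⟩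
      exact ih r.toState hrest hdom' hInv' r' hmem t ht hle


end Summit.NavierStokesRegularity.NavierStokesRegularity.Cruxes.RelayFrontStep.Window2
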